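import Literature.Analysis.FluidPDE.LeslieShvydkoy2018SlicePressure
import Literature.Analysis.FluidPDE.ClassicalLocalEnergyNoJump
import Literature.Analysis.FluidPDE.MildSolutionProofs
import HarnessLib

/-!
# Leslie–Shvydkoy 2018, Prop. 3.2 / 4.2: the flux of the local energy identity at one time,
# bounded by the dyadic energy supremum

Analysis/FluidPDE proofs file (theorems only; no definitions, no named facts) on the discharge
path of the named fact `Literature.Analysis.FluidPDE.leslieShvydkoy2018_morreyBound`
(`LeslieShvydkoy2018MorreyBound.lean`; T. M. Leslie, R. Shvydkoy, ARMA 230 (2018) =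
arXiv:1705.04420, Prop. 3.2 + 4.2). It renders the slice estimates inside the proof of
**Lemma 3.6** (p. 11) and of its Navier–Stokes version **(4.1)** (p. 13): with the
time-independent cut-off `φ = ψ(|x - x₀|/r)` in the local energy (in)equality,

> "`E(t,r) ≤ E(s,r) + (C/r) ∫_s^t ∫_{B_r} |u|³ + |p - (p)_r||u| dx dτ` … Applying the obvious
> pointwise bounds" (p. 11), and for Navier–Stokes "the second term of (4.0)
> [`ν ∫∫ |u|² Δφ`] can clearly be bounded above by `(C/r²) ∫_{Q} |u|²`" (p. 13),

the three flux terms at a time `τ` — `|ν| ∫ |Δφ||u|²`, `∫ ‖Dφ‖|u|³` and `2∫ |p - c| ‖Dφ‖ |u|` of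
the tree's `IsClassicalNSSolutionOn.integral_flux_le` (`ClassicalLocalEnergyNoJump.lean`) — are
bounded by `(|ν|/ρ² + f(τ)/ρ) · W_ρ(u(τ))` up to an absolute constant, where
`W_ρ = dyadicEnergySup` is the dyadic energy supremum of `LeslieShvydkoy2018DyadicEnergy.lean` and
the pressure term is the slice bound of `LeslieShvydkoy2018SlicePressure.lean` (the classical
pressure being gauged to the normalised pressure `p(τ) - c(τ) = p̃[u(τ)]`, as it is at a.e. time by
the tree's `exists_pressure_gauge_of_classical`).

* `cutoffAt`-lemmas (`cutoff_translate_*`) — the translated cut-off `x ↦ cutoff ρ (x - x₀)` of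
  `WholeSpaceIBP.lean`: smooth, `= 1` on `B(x₀, ρ)`, supported in `B̄(x₀, 2ρ)`, `0 ≤ φ ≤ 1`,
  `‖Dφ‖ ≤ C₁/ρ`, `|Δφ| ≤ C₂/ρ²` uniformly in `x₀`, `ρ`;
* `exists_flux_cutoff_le` — **the slice flux bound**: for a classical solution on an open time
  set `S`, `τ ∈ S` with `p(τ) - c = p̃[u(τ)]`, `u(τ) ∈ L²`, `‖u(τ)‖ ≤ F`:
  `ofReal (∫ (νΔφ|u|² + Dφ(u)|u|² + 2pDφ(u))) ≤ K (|ν|/ρ² + F/ρ) W_ρ(u(τ))`.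

## References

* T. M. Leslie, R. Shvydkoy, ARMA 230 (2018) = arXiv:1705.04420, §3.4, proof of Lemma 3.6
  (p. 11) and §4, (4.0)–(4.1) (p. 13). [`LeslieShvydkoy2017`]
* L. Caffarelli, R. Kohn, L. Nirenberg, CPAM 35 (1982), §2 (2.5). [`CaffarelliKohnNirenberg1982`]
-/

noncomputable section

open MeasureTheory Set Metric Filter Function InnerProductSpace
open _root_.Topology
open scoped ENNReal NNReal RealInnerProductSpace Laplacian ContDiff

namespace Literature.Analysis.FluidPDE

namespace LeslieShvydkoy2018

/-! ### The translated cut-off -/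

section Cutoff

variable {x₀ x : EuclideanSpace ℝ (Fin 3)} {ρ : ℝ}

/-- Translation commutes with the Laplacian on `ℝ³`: `Δ(f(· - a))(x) = (Δf)(x - a)`. [folklore] -/
private theorem laplacian_comp_sub_apply (f : EuclideanSpace ℝ (Fin 3) → ℝ)
    (a x : EuclideanSpace ℝ (Fin 3)) : (Δ (fun y => f (y - a))) x = (Δ f) (x - a) := by
  rw [laplacian_eq_iteratedFDeriv_stdOrthonormalBasis, laplacian_eq_iteratedFDeriv_stdOrthonormalBasis]
  simp only [sub_eq_add_neg, iteratedFDeriv_comp_add_right]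

/-- The translated cut-off `x ↦ cutoff ρ (x - x₀)` (the paper's `φ_r(x) = ψ(|x - x₀|/r)`) is
smooth. [cite: LeslieShvydkoy2017, §3.4, the cut-off `φ_r` (p. 10)] -/
theorem contDiff_cutoff_translate (x₀ : EuclideanSpace ℝ (Fin 3)) (ρ : ℝ) :
    ContDiff ℝ ∞ (fun x : EuclideanSpace ℝ (Fin 3) => cutoff ρ (x - x₀)) :=
  (contDiff_cutoff (n := ⊤) ρ).comp (contDiff_id.sub contDiff_const)

/-- The translated cut-off vanishes off the open ball `B(x₀, 2ρ)` (`ρ > 0`; "supported inside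
`{|x| < 1}`" at scale `r`). [cite: LeslieShvydkoy2017, §3.4, the cut-off `φ_r` (p. 10)] -/
theorem cutoff_translate_eq_zero (hρ : 0 < ρ) (hx : x ∉ ball x₀ (2 * ρ)) :
    cutoff ρ (x - x₀) = 0 := by
  rw [mem_ball, dist_eq_norm, not_lt] at hx
  exact cutoff_eq_zero hρ hx

/-- The translated cut-off equals `1` on `B(x₀, ρ)` (`ρ > 0`; "equal to 1 on `{|x| ≤ 1/2}`" at
scale `r`). [cite: LeslieShvydkoy2017, §3.4, the cut-off `φ_r` (p. 10)] -/
theorem cutoff_translate_eq_one (hρ : 0 < ρ) (hx : x ∈ ball x₀ ρ) : cutoff ρ (x - x₀) = 1 := by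
  rw [mem_ball, dist_eq_norm] at hx
  exact cutoff_eq_one hρ hx.le

/-- The translated cut-off has topological support in `B̄(x₀, 2ρ)` (`ρ > 0`).
[cite: LeslieShvydkoy2017, §3.4, the cut-off `φ_r` (p. 10)] -/
theorem tsupport_cutoff_translate_subset (hρ : 0 < ρ) :
    tsupport (fun x : EuclideanSpace ℝ (Fin 3) => cutoff ρ (x - x₀)) ⊆ closedBall x₀ (2 * ρ) := by
  refine closure_minimal (fun x hx => ?_) isClosed_closedBall
  rw [mem_support] at hx
  by_contra h
  exact hx (cutoff_translate_eq_zero hρ fun h' => h (ball_subset_closedBall h'))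

/-- The translated cut-off has compact support (`ρ > 0`).
[cite: LeslieShvydkoy2017, §3.4, the cut-off `φ_r` (p. 10)] -/
theorem hasCompactSupport_cutoff_translate (hρ : 0 < ρ) :
    HasCompactSupport (fun x : EuclideanSpace ℝ (Fin 3) => cutoff ρ (x - x₀)) :=
  IsCompact.of_isClosed_subset (isCompact_closedBall x₀ (2 * ρ)) (isClosed_tsupport _)
    (tsupport_cutoff_translate_subset hρ)

/-- **Uniform bounds for the derivatives of the translated cut-offs**: there are `C₁, C₂ ≥ 0`
with `‖D(cutoff ρ (· - x₀))(x)‖ ≤ C₁/ρ` and `|Δ(cutoff ρ (· - x₀))(x)| ≤ C₂/ρ²` for all `x₀`,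
`ρ > 0`, `x` ("`|∇φ_r| ≤ C r⁻¹`", p. 10; translation invariance and the tree's bounds
`exists_norm_fderiv_cutoff_le`, `exists_abs_laplacian_cutoff_le`).
[cite: LeslieShvydkoy2017, §3.1, bounds after (3.6) (p. 10)] -/
theorem exists_cutoff_translate_bounds :
    ∃ C₁ C₂ : ℝ, 0 ≤ C₁ ∧ 0 ≤ C₂ ∧ ∀ (x₀ : EuclideanSpace ℝ (Fin 3)) (ρ : ℝ), 0 < ρ →
      ∀ x : EuclideanSpace ℝ (Fin 3),
        ‖fderiv ℝ (fun y : EuclideanSpace ℝ (Fin 3) => cutoff ρ (y - x₀)) x‖ ≤ C₁ / ρ ∧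
        |(Δ (fun y : EuclideanSpace ℝ (Fin 3) => cutoff ρ (y - x₀))) x| ≤ C₂ / ρ ^ 2 := by
  obtain ⟨C₁, hC₁0, hC₁⟩ := exists_norm_fderiv_cutoff_le (E := EuclideanSpace ℝ (Fin 3))
  obtain ⟨C₂, hC₂0, hC₂⟩ := exists_abs_laplacian_cutoff_le (E := EuclideanSpace ℝ (Fin 3))
  refine ⟨C₁, C₂, hC₁0, hC₂0, fun x₀ ρ hρ x => ⟨?_, ?_⟩⟩
  · rw [fderiv_comp_sub]
    exact hC₁ ρ hρ (x - x₀)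
  · rw [laplacian_comp_sub_apply]
    exact hC₂ ρ hρ (x - x₀)

end Cutoff

/-! ### Integration tools -/

/-- **From a pointwise bound on a set to a bound of the integral**: if `G` is integrable, vanishes
off `S`, and `|G| ≤ Ψ` on `S` with `Ψ` integrable on `S`, then `∫ G ≤ ∫_S Ψ`. [folklore] -/
private theorem integral_le_setIntegral_of_abs_le' {α : Type*} [MeasurableSpace α] {μ : Measure α}
    {G Ψ : α → ℝ} {S : Set α} (hSm : MeasurableSet S) (hG : Integrable G μ)
    (hΨ : IntegrableOn Ψ S μ) (h0 : ∀ z, z ∉ S → G z = 0) (hle : ∀ z ∈ S, |G z| ≤ Ψ z) :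
    ∫ z, G z ∂μ ≤ ∫ z in S, Ψ z ∂μ := by
  rw [← integral_indicator hSm]
  refine ((le_abs_self _).trans abs_integral_le_integral_abs).trans ?_
  refine integral_mono hG.abs (hΨ.integrable_indicator hSm) fun z => ?_
  by_cases hz : z ∈ S
  · rw [indicator_of_mem hz]; exact hle z hz
  · rw [indicator_of_notMem hz, h0 z hz, abs_zero]

/-- The real ball integral of `‖v‖²` for continuous `v` is the lower integral:
`ofReal (∫_B ‖v‖²) = ∫⁻_B ‖v‖ₑ²` on a ball. [folklore] -/
private theorem ofReal_setIntegral_norm_sq_eq {v : EuclideanSpace ℝ (Fin 3) → EuclideanSpace ℝ (Fin 3)}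
    (hv : Continuous v) (x₀ : EuclideanSpace ℝ (Fin 3)) (R : ℝ) :
    ENNReal.ofReal (∫ x in ball x₀ R, ‖v x‖ ^ 2) = ∫⁻ x in ball x₀ R, ‖v x‖ₑ ^ 2 := by
  have hint : IntegrableOn (fun x => ‖v x‖ ^ 2) (ball x₀ R) volume :=
    ((hv.norm.pow 2).continuousOn.integrableOn_compact (isCompact_closedBall x₀ R)).mono_set
      ball_subset_closedBall
  rw [ofReal_integral_eq_lintegral_ofReal hint (ae_of_all _ fun x => sq_nonneg _)]
  refine lintegral_congr fun x => ?_
  rw [← ofReal_norm, ← ENNReal.ofReal_pow (norm_nonneg _)]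

/-- The real ball integral of `|G| ‖v‖` for continuous `G`, `v` is the lower integral.
[folklore] -/
private theorem ofReal_setIntegral_abs_mul_norm_eq {G : EuclideanSpace ℝ (Fin 3) → ℝ}
    {v : EuclideanSpace ℝ (Fin 3) → EuclideanSpace ℝ (Fin 3)} (hG : Continuous G)
    (hv : Continuous v) (x₀ : EuclideanSpace ℝ (Fin 3)) (R : ℝ) :
    ENNReal.ofReal (∫ x in ball x₀ R, |G x| * ‖v x‖) = ∫⁻ x in ball x₀ R, ‖G x‖ₑ * ‖v x‖ₑ := by
  have hint : IntegrableOn (fun x => |G x| * ‖v x‖) (ball x₀ R) volume :=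
    (((continuous_abs.comp hG).mul hv.norm).continuousOn.integrableOn_compact
      (isCompact_closedBall x₀ R)).mono_set ball_subset_closedBall
  rw [ofReal_integral_eq_lintegral_ofReal hint (ae_of_all _ fun x => by positivity)]
  refine lintegral_congr fun x => ?_
  rw [ENNReal.ofReal_mul (abs_nonneg _), ← Real.norm_eq_abs, ofReal_norm, ofReal_norm]

/-! ### The flux bound at one time -/

variable {S : Set ℝ} {ν : ℝ} {u : ℝ → EuclideanSpace ℝ (Fin 3) → EuclideanSpace ℝ (Fin 3)}
  {p : ℝ → EuclideanSpace ℝ (Fin 3) → ℝ}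

/-- `W_{4ρ} ≤ 64 W_ρ` (two rescalings). [cite: LeslieShvydkoy2017, §3.4 (3.11') (p. 11)] -/
theorem dyadicEnergySup_four_mul_le {v : EuclideanSpace ℝ (Fin 3) → EuclideanSpace ℝ (Fin 3)}
    {x₀ : EuclideanSpace ℝ (Fin 3)} {ρ : ℝ} :
    dyadicEnergySup v x₀ (4 * ρ) ≤ 64 * dyadicEnergySup v x₀ ρ := by
  calc dyadicEnergySup v x₀ (4 * ρ) = dyadicEnergySup v x₀ (2 * (2 * ρ)) := by ring_nf
    _ ≤ 8 * dyadicEnergySup v x₀ (2 * ρ) := dyadicEnergySup_two_mul_le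
    _ ≤ 8 * (8 * dyadicEnergySup v x₀ ρ) := by gcongr; exact dyadicEnergySup_two_mul_le
    _ = 64 * dyadicEnergySup v x₀ ρ := by ring

/-- `∫_{B(x₀,4ρ)} |v|² ≤ 64 W_ρ(v)`. [cite: LeslieShvydkoy2017, §3.4 (3.12') (p. 11)] -/
theorem ballEnergySq_four_mul_le {v : EuclideanSpace ℝ (Fin 3) → EuclideanSpace ℝ (Fin 3)}
    {x₀ : EuclideanSpace ℝ (Fin 3)} {ρ : ℝ} :
    ∫⁻ y in ball x₀ (4 * ρ), ‖v y‖ₑ ^ 2 ≤ 64 * dyadicEnergySup v x₀ ρ := by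
  have h := ballEnergySq_le_pow_mul_dyadicEnergySup (v := v) (x₀ := x₀) (R := ρ) 2
  norm_num at h
  exact h

/-- **The flux of the local energy identity at one time is controlled by the dyadic energy
supremum** (Leslie–Shvydkoy 2018, the "obvious pointwise bounds" of the proof of Lemma 3.6,
p. 11, with the viscous term of (4.0)–(4.1), p. 13). There is an absolute `K` such that: for a
classical solution `(u, p)` of the unforced Navier–Stokes system on an open time set `S`, a time
`τ ∈ S` at which the pressure is gauged to the normalised pressure (`p(τ) - c = p̃[u(τ)]`),
with `u(τ) ∈ L²` and `‖u(τ)‖ ≤ F`, every centre `x₀` and scale `ρ > 0`, the flux against the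
cut-off `φ = cutoff ρ (· - x₀)` satisfies
`ofReal (∫ (νΔφ |u|² + Dφ(u)|u|² + 2 p Dφ(u))) ≤ K (|ν|/ρ² + F/ρ) W_ρ(u(τ))`.
[cite: LeslieShvydkoy2017, §3.4 proof of Lemma 3.6 (p. 11) and §4 (4.0)–(4.1) (p. 13)] -/
theorem exists_flux_cutoff_le :
    ∃ K : ℝ≥0, ∀ (S : Set ℝ) (ν : ℝ) (u : ℝ → EuclideanSpace ℝ (Fin 3) → EuclideanSpace ℝ (Fin 3))
      (p : ℝ → EuclideanSpace ℝ (Fin 3) → ℝ), IsClassicalNSSolutionOn S ν 0 u p →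
      ∀ (τ : ℝ), τ ∈ S → ∀ (c F : ℝ), (∀ x, p τ x - c = normalisedPressure (u τ) x) →
      MemLp (u τ) 2 volume → (∀ x, ‖u τ x‖ ≤ F) →
      ∀ (x₀ : EuclideanSpace ℝ (Fin 3)) (ρ : ℝ), 0 < ρ →
        ENNReal.ofReal (∫ x, (ν * ((Δ (fun y : EuclideanSpace ℝ (Fin 3) => cutoff ρ (y - x₀))) x *
            ‖u τ x‖ ^ 2) +
          fderiv ℝ (fun y : EuclideanSpace ℝ (Fin 3) => cutoff ρ (y - x₀)) x (u τ x) * ‖u τ x‖ ^ 2 +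
          2 * (p τ x * fderiv ℝ (fun y : EuclideanSpace ℝ (Fin 3) => cutoff ρ (y - x₀)) x (u τ x))))
        ≤ K * (ENNReal.ofReal (|ν| / ρ ^ 2) + ENNReal.ofReal (F / ρ)) * dyadicEnergySup (u τ) x₀ ρ := by
  obtain ⟨C₁, C₂, hC₁0, hC₂0, hC⟩ := exists_cutoff_translate_bounds
  obtain ⟨CB, hCB⟩ := exists_lintegral_pressure_oscillation_mul_velocity_le
  refine ⟨(64 * (C₂ + C₁ + 2 * C₁ * CB)).toNNReal,
    fun S ν u p hsol τ hτ c F hgauge hL2 hF x₀ ρ hρ => ?_⟩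
  have hF0 : 0 ≤ F := (norm_nonneg _).trans (hF x₀)
  -- the cut-off
  set φ : EuclideanSpace ℝ (Fin 3) → ℝ := fun y => cutoff ρ (y - x₀) with hφdef
  have hφs : ContDiff ℝ ∞ φ := contDiff_cutoff_translate x₀ ρ
  have hφc : HasCompactSupport φ := hasCompactSupport_cutoff_translate hρ
  have hφsupp : tsupport φ ⊆ closedBall x₀ (2 * ρ) := tsupport_cutoff_translate_subset hρ
  have hD : ∀ x, ‖fderiv ℝ φ x‖ ≤ C₁ / ρ := fun x => (hC x₀ ρ hρ x).1
  have hΔ : ∀ x, |(Δ φ) x| ≤ C₂ / ρ ^ 2 := fun x => (hC x₀ ρ hρ x).2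
  -- the big ball containing the support
  set B : Set (EuclideanSpace ℝ (Fin 3)) := ball x₀ (4 * ρ) with hB
  have hsub : closedBall x₀ (2 * ρ) ⊆ B := closedBall_subset_ball (by linarith)
  have hoffD : ∀ x, x ∉ B → fderiv ℝ φ x = 0 := fun x hx =>
    fderiv_of_notMem_tsupport ℝ fun h => hx (hsub (hφsupp h))
  have hoffΔ : ∀ x, x ∉ B → (Δ φ) x = 0 := fun x hx =>
    laplacian_eq_zero_of_notMem_tsupport fun h => hx (hsub (hφsupp h))
  -- continuity of the players
  have hu : Continuous (u τ) := (hsol.contDiff_velocity hτ).continuous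
  have hpc : Continuous (p τ) := (hsol.contDiff_pressure hτ).continuous
  have hφ1 : ContDiff ℝ 1 φ := hφs.of_le (by norm_cast)
  have hφ2 : ContDiff ℝ 2 φ := hφs.of_le (by norm_cast)
  have hΔc : Continuous (Δ φ) := continuous_laplacian hφ2
  have hDc : Continuous (fderiv ℝ φ) := hφ1.continuous_fderiv one_ne_zero
  -- the gauged pressure and its mean on `B`
  set P : EuclideanSpace ℝ (Fin 3) → ℝ := fun x => p τ x - c with hPdef
  have hPeq : P = normalisedPressure (u τ) := funext hgauge
  have hPc : Continuous P := hpc.sub continuous_const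
  have hP32 : MemLp P (3 / 2) volume := by
    rw [hPeq]; exact memLp_normalisedPressure_threeHalves hL2 hF
  have hPpoisson : ∀ θ : EuclideanSpace ℝ (Fin 3) → ℝ, ContDiff ℝ (⊤ : ℕ∞) θ →
      HasCompactSupport θ → ∫ x, P x * (Δ θ) x = -∫ x, fderiv ℝ (fderiv ℝ θ) x (u τ x) (u τ x) := by
    intro θ hθ hθc
    rw [hPeq]; exact integral_normalisedPressure_mul_laplacian_threeHalves hL2 hF hθ hθc
  set m : ℝ := ⨍ z in B, P z with hm
  -- ## the flux bound with the gauge `c + m`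
  have hflux := hsol.integral_flux_le hφs hφc hτ (c + m)
  -- integrability of the three integrands (continuous, supported in `B`)
  have hK : IsCompact (closedBall x₀ (4 * ρ)) := isCompact_closedBall _ _
  have iT1 : Integrable (fun x => |(Δ φ) x| * ‖u τ x‖ ^ 2) volume :=
    ((continuous_abs.comp hΔc).mul (hu.norm.pow 2)).integrable_of_hasCompactSupport
      (HasCompactSupport.intro hK fun x hx => by
        simp [hoffΔ x fun h => hx (ball_subset_closedBall h)])
  have iT2 : Integrable (fun x => ‖fderiv ℝ φ x‖ * ‖u τ x‖ ^ 3) volume :=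
    (hDc.norm.mul (hu.norm.pow 3)).integrable_of_hasCompactSupport
      (HasCompactSupport.intro hK fun x hx => by
        simp [hoffD x fun h => hx (ball_subset_closedBall h)])
  have iT3 : Integrable (fun x => |p τ x - (c + m)| * ‖fderiv ℝ φ x‖ * ‖u τ x‖) volume :=
    (((continuous_abs.comp (hpc.sub continuous_const)).mul hDc.norm).mul hu.norm)
      |>.integrable_of_hasCompactSupport (HasCompactSupport.intro hK fun x hx => by
        simp [hoffD x fun h => hx (ball_subset_closedBall h)])
  -- real majorants on `B`
  have icont : ∀ {g : EuclideanSpace ℝ (Fin 3) → ℝ}, Continuous g → IntegrableOn g B volume :=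
    fun hg => (hg.continuousOn.integrableOn_compact hK).mono_set ball_subset_closedBall
  set b : ℝ := ∫ x in B, ‖u τ x‖ ^ 2 with hb
  set q : ℝ := ∫ x in B, |P x - m| * ‖u τ x‖ with hq
  have hT1 : ∫ x, |(Δ φ) x| * ‖u τ x‖ ^ 2 ≤ C₂ / ρ ^ 2 * b := by
    rw [hb, ← integral_const_mul]
    refine integral_le_setIntegral_of_abs_le' measurableSet_ball iT1
      (icont (continuous_const.mul (hu.norm.pow 2))) (fun x hx => by rw [hoffΔ x hx]; simp)
      fun x _ => ?_
    rw [abs_mul, abs_abs, abs_pow, abs_norm]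
    exact mul_le_mul_of_nonneg_right (hΔ x) (by positivity)
  have hT2 : ∫ x, ‖fderiv ℝ φ x‖ * ‖u τ x‖ ^ 3 ≤ C₁ / ρ * F * b := by
    rw [hb, ← integral_const_mul]
    refine integral_le_setIntegral_of_abs_le' measurableSet_ball iT2
      (icont (continuous_const.mul (hu.norm.pow 2))) (fun x hx => by rw [hoffD x hx]; simp)
      fun x _ => ?_
    rw [abs_mul, abs_norm, abs_pow, abs_norm]
    calc ‖fderiv ℝ φ x‖ * ‖u τ x‖ ^ 3 = ‖fderiv ℝ φ x‖ * (‖u τ x‖ * ‖u τ x‖ ^ 2) := by ring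
      _ ≤ C₁ / ρ * (F * ‖u τ x‖ ^ 2) := by gcongr; exacts [hD x, hF x]
      _ = C₁ / ρ * F * ‖u τ x‖ ^ 2 := by ring
  have hT3 : ∫ x, |p τ x - (c + m)| * ‖fderiv ℝ φ x‖ * ‖u τ x‖ ≤ C₁ / ρ * q := by
    rw [hq, ← integral_const_mul]
    refine integral_le_setIntegral_of_abs_le' measurableSet_ball iT3
      (icont (continuous_const.mul ((continuous_abs.comp (hPc.sub continuous_const)).mul hu.norm)))
      (fun x hx => by rw [hoffD x hx]; simp) fun x _ => ?_
    have e : p τ x - (c + m) = P x - m := by rw [hPdef]; ring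
    rw [e, abs_mul, abs_mul, abs_abs, abs_norm, abs_norm]
    calc |P x - m| * ‖fderiv ℝ φ x‖ * ‖u τ x‖ = ‖fderiv ℝ φ x‖ * (|P x - m| * ‖u τ x‖) := by ring
      _ ≤ C₁ / ρ * (|P x - m| * ‖u τ x‖) := by gcongr; exact hD x
  have hb0 : 0 ≤ b := integral_nonneg fun x => sq_nonneg _
  have hq0 : 0 ≤ q := integral_nonneg fun x => by positivity
  -- the real bound of the flux
  have hreal : (∫ x, (ν * ((Δ φ) x * ‖u τ x‖ ^ 2) + fderiv ℝ φ x (u τ x) * ‖u τ x‖ ^ 2 +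
      2 * (p τ x * fderiv ℝ φ x (u τ x)))) ≤
      (C₂ * (|ν| / ρ ^ 2) + C₁ * (F / ρ)) * b + 2 * (C₁ / ρ) * q := by
    have h1 : |ν| * ∫ x, |(Δ φ) x| * ‖u τ x‖ ^ 2 ≤ |ν| * (C₂ / ρ ^ 2 * b) :=
      mul_le_mul_of_nonneg_left hT1 (abs_nonneg ν)
    have e : |ν| * (C₂ / ρ ^ 2 * b) + C₁ / ρ * F * b + 2 * (C₁ / ρ * q) =
        (C₂ * (|ν| / ρ ^ 2) + C₁ * (F / ρ)) * b + 2 * (C₁ / ρ) * q := by ring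
    linarith
  -- ## conversion to `ℝ≥0∞`
  set W : ℝ≥0∞ := dyadicEnergySup (u τ) x₀ ρ with hW
  have hbB : ENNReal.ofReal b ≤ 64 * W := by
    rw [hb, ofReal_setIntegral_norm_sq_eq hu]
    exact ballEnergySq_four_mul_le
  have hqQ : ENNReal.ofReal q ≤ CB * (ENNReal.ofReal F * (64 * W)) := by
    have e : ENNReal.ofReal q = ∫⁻ x in B, ‖P x - m‖ₑ * ‖u τ x‖ₑ := by
      simpa using ofReal_setIntegral_abs_mul_norm_eq (G := fun x => P x - m)
        (hPc.sub continuous_const) hu x₀ (4 * ρ)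
    rw [e]
    refine (hCB x₀ (4 * ρ) F (u τ) P (by linarith) hL2 hF hP32 hPpoisson).trans ?_
    gcongr
    exact dyadicEnergySup_four_mul_le
  have hκ0 : 0 ≤ C₂ * (|ν| / ρ ^ 2) + C₁ * (F / ρ) := by positivity
  calc ENNReal.ofReal (∫ x, (ν * ((Δ φ) x * ‖u τ x‖ ^ 2) + fderiv ℝ φ x (u τ x) * ‖u τ x‖ ^ 2 +
        2 * (p τ x * fderiv ℝ φ x (u τ x))))
      ≤ ENNReal.ofReal ((C₂ * (|ν| / ρ ^ 2) + C₁ * (F / ρ)) * b + 2 * (C₁ / ρ) * q) :=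
        ENNReal.ofReal_le_ofReal hreal
    _ = ENNReal.ofReal (C₂ * (|ν| / ρ ^ 2) + C₁ * (F / ρ)) * ENNReal.ofReal b +
          ENNReal.ofReal (2 * (C₁ / ρ)) * ENNReal.ofReal q := by
        rw [ENNReal.ofReal_add (mul_nonneg hκ0 hb0) (by positivity), ENNReal.ofReal_mul hκ0,
          ENNReal.ofReal_mul (by positivity)]
    _ ≤ ENNReal.ofReal (C₂ * (|ν| / ρ ^ 2) + C₁ * (F / ρ)) * (64 * W) +
          ENNReal.ofReal (2 * (C₁ / ρ)) * (CB * (ENNReal.ofReal F * (64 * W))) := by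
        gcongr
    _ = 64 * (ENNReal.ofReal (C₂ * (|ν| / ρ ^ 2) + C₁ * (F / ρ)) +
          CB * ENNReal.ofReal (2 * C₁ * (F / ρ))) * W := by
        have e : ENNReal.ofReal (2 * (C₁ / ρ)) * ENNReal.ofReal F =
            ENNReal.ofReal (2 * C₁ * (F / ρ)) := by
          rw [← ENNReal.ofReal_mul (by positivity)]; congr 1; field_simp
        calc ENNReal.ofReal (C₂ * (|ν| / ρ ^ 2) + C₁ * (F / ρ)) * (64 * W) +
              ENNReal.ofReal (2 * (C₁ / ρ)) * (CB * (ENNReal.ofReal F * (64 * W)))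
            = 64 * (ENNReal.ofReal (C₂ * (|ν| / ρ ^ 2) + C₁ * (F / ρ)) +
                CB * (ENNReal.ofReal (2 * (C₁ / ρ)) * ENNReal.ofReal F)) * W := by ring
          _ = _ := by rw [e]
    _ ≤ 64 * (ENNReal.ofReal (C₂ + C₁ + 2 * C₁ * CB) *
          (ENNReal.ofReal (|ν| / ρ ^ 2) + ENNReal.ofReal (F / ρ))) * W := by
        gcongr 64 * ?_ * W
        -- both summands are dominated termwise
        have hx : 0 ≤ |ν| / ρ ^ 2 := by positivity
        have hy : 0 ≤ F / ρ := div_nonneg hF0 hρ.le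
        have h1 : ENNReal.ofReal (C₂ * (|ν| / ρ ^ 2) + C₁ * (F / ρ)) ≤
            ENNReal.ofReal (C₂ + C₁) * (ENNReal.ofReal (|ν| / ρ ^ 2) + ENNReal.ofReal (F / ρ)) := by
          rw [← ENNReal.ofReal_add hx hy, ← ENNReal.ofReal_mul (by positivity)]
          refine ENNReal.ofReal_le_ofReal ?_
          nlinarith [mul_nonneg hC₂0 hy, mul_nonneg hC₁0 hx]
        have h2 : (CB : ℝ≥0∞) * ENNReal.ofReal (2 * C₁ * (F / ρ)) ≤
            ENNReal.ofReal (2 * C₁ * CB) * (ENNReal.ofReal (|ν| / ρ ^ 2) + ENNReal.ofReal (F / ρ)) := by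
          have eCB : (CB : ℝ≥0∞) = ENNReal.ofReal (CB : ℝ) := (ENNReal.ofReal_coe_nnreal).symm
          rw [eCB, ← ENNReal.ofReal_mul CB.coe_nonneg, ← ENNReal.ofReal_add hx hy,
            ← ENNReal.ofReal_mul (by positivity)]
          refine ENNReal.ofReal_le_ofReal ?_
          nlinarith [mul_nonneg (mul_nonneg (mul_nonneg zero_le_two hC₁0) CB.coe_nonneg) hx]
        calc ENNReal.ofReal (C₂ * (|ν| / ρ ^ 2) + C₁ * (F / ρ)) + CB * ENNReal.ofReal (2 * C₁ * (F / ρ))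
            ≤ ENNReal.ofReal (C₂ + C₁) * (ENNReal.ofReal (|ν| / ρ ^ 2) + ENNReal.ofReal (F / ρ)) +
              ENNReal.ofReal (2 * C₁ * CB) * (ENNReal.ofReal (|ν| / ρ ^ 2) + ENNReal.ofReal (F / ρ)) :=
              add_le_add h1 h2
          _ = ENNReal.ofReal (C₂ + C₁ + 2 * C₁ * CB) *
              (ENNReal.ofReal (|ν| / ρ ^ 2) + ENNReal.ofReal (F / ρ)) := by
              rw [← add_mul, ← ENNReal.ofReal_add (by positivity) (by positivity)]
    _ = ((64 * (C₂ + C₁ + 2 * C₁ * CB)).toNNReal : ℝ≥0∞) *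
          (ENNReal.ofReal (|ν| / ρ ^ 2) + ENNReal.ofReal (F / ρ)) * W := by
        have e64 : (((64 * (C₂ + C₁ + 2 * C₁ * CB)).toNNReal : ℝ≥0) : ℝ≥0∞) =
            64 * ENNReal.ofReal (C₂ + C₁ + 2 * C₁ * CB) := by
          rw [Real.toNNReal_mul (by norm_num), Real.toNNReal_ofNat, ENNReal.coe_mul, ENNReal.ofReal]
          norm_num
        rw [e64]
        ring

end LeslieShvydkoy2018

end Literature.Analysis.FluidPDE

end
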